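import Mathlib
import Summits.ValiantsHypothesis.ValiantsHypothesis.Theorems.RigidityForcesSymmetryRankRigidMinimalReprLaplaceDual
import Summits.ValiantsHypothesis.ValiantsHypothesis.Theorems.RigidityForcesSymmetryRankRigidMinimalReprLaplaceHybridWitness

/-!
# `LaplaceOptimalFive`: decompositions of `P₅` refuted by a hybrid dual certificate
# (crux `RankRigidMinimalRepr`, stmt-ValiantsHypothesis-18034; frontier rung `LaplaceOptimalFive`, stmt-24813)

`certified_no_decomposition`: a purported decomposition of the `5 × 5` permutation pattern into `Ns` slices
(`α_k(v_{i k}) · W_k`, `W_k` blind to slot `i k`) and `Np` pair terms (`u_t(v_{p t}, v_{q t}) · w_t`, `w_t` blind to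
the two slots) is IMPOSSIBLE as soon as a HYBRID CERTIFICATE exists: an order `ord` of the slots, `b` leading basis
positions with distinct basis columns `cb`, for every pair term a kill side (its 2-slot side, charged to the later of
`p t, q t`; or its 3-slot side, charged to the last of the three complementary slots `e1 t, e2 t, lp t`), such that no
term is charged to a basis slot and the COUNT holds at every general position `j`: `#terms charged to ord j + j ≤ 4`,
or `≤ 5` when a slice `α_k` at that slot has `α_k(cb r) ≠ 0` for a basis column.  The certificate conditions are
decidable from the profile (slots, sides, order) except the bonus `α_k(cb r) ≠ 0` (choose `cb r` in the support).
Proof: `LaplaceTriangular.hybrid_witness` produces covectors killing every term with non-zero permanent;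
`LaplaceDual.no_decomposition_of_witness` concludes (w-side kills through `pairing_compl_three`).

By exhaustive search (evidence note NOTE-p8g10-24813 on the item; `cert.py`) certificates OF THIS SHAPE exist for 240
of the 1 618 maximal cheap profiles of `P₅`: all 16 with four slices, 97 of the 107 with three, 127 of the 350 with two,
none with `≤ 1` slice (the stronger game with interleaved basis rows and absorbed pair vectors reaches 107 and 228).
HONEST FRAMING: an exact partial result toward the frontier rung `LaplaceOptimalFive` (stmt-24813), which stays OPEN;
nothing here bears on `VP ≠ VNP`.
-/

set_option autoImplicit false

-- the mandated summit-side namespace repeats a component by design (single-problem summit)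
set_option linter.dupNamespace false

namespace Summit.ValiantsHypothesis.ValiantsHypothesis.Theorems.RigidityForcesSymmetryRankRigidMinimalRepr

namespace LaplaceFiveSlices

open Finset

/-! ### §1 The `w`-side pairing of a pair term (three complementary slots) -/

/-- Five pairwise distinct slots exhaust `Fin 5`. -/
theorem mem_of_five_distinct : ∀ (p q e1 e2 e3 j : Fin 5), p ≠ q → p ≠ e1 → p ≠ e2 → p ≠ e3 → q ≠ e1 → q ≠ e2 →
    q ≠ e3 → e1 ≠ e2 → e1 ≠ e3 → e2 ≠ e3 → (j = p ∨ j = q ∨ j = e1 ∨ j = e2 ∨ j = e3) := by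
  decide

/-- **The `{p,q}ᶜ`-pairing of a pair term's `w`-factor** (`{p,q,e1,e2,e3} = Fin 5`): it is the trilinear form
`Σ_{x,y,z} φ_{e1}(x) φ_{e2}(y) φ_{e3}(z) · w(c₀[e1 ↦ x][e2 ↦ y][e3 ↦ z])`. -/
theorem pairing_compl_three (c₀ p q e1 e2 e3 : Fin 5) (hpq : p ≠ q) (h1 : p ≠ e1) (h2 : p ≠ e2) (h3 : p ≠ e3)
    (h4 : q ≠ e1) (h5 : q ≠ e2) (h6 : q ≠ e3) (h7 : e1 ≠ e2) (h8 : e1 ≠ e3) (h9 : e2 ≠ e3)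
    (φ : Fin 5 → Fin 5 → ℂ) (w : (Fin 5 → Fin 5) → ℂ) :
    (∑ v : Fin 5 → Fin 5,
        (∏ j, if j ∈ ({p, q} : Finset (Fin 5)) then (if v j = c₀ then 1 else 0) else φ j (v j)) * w v) =
      ∑ xyz : Fin 5 × Fin 5 × Fin 5, φ e1 xyz.1 * φ e2 xyz.2.1 * φ e3 xyz.2.2 *
        w (Function.update (Function.update (Function.update (fun _ => c₀) e1 xyz.1) e2 xyz.2.1) e3 xyz.2.2) := by
  classical
  set f : Fin 5 × Fin 5 × Fin 5 → (Fin 5 → Fin 5) :=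
    fun xyz => Function.update (Function.update (Function.update (fun _ => c₀) e1 xyz.1) e2 xyz.2.1) e3 xyz.2.2
    with hf
  have hf1 : ∀ xyz, f xyz e1 = xyz.1 := fun xyz => by
    simp [hf, Function.update_of_ne h8, Function.update_of_ne h7]
  have hf2 : ∀ xyz, f xyz e2 = xyz.2.1 := fun xyz => by simp [hf, Function.update_of_ne h9]
  have hf3 : ∀ xyz, f xyz e3 = xyz.2.2 := fun xyz => by simp [hf]
  have hfp : ∀ xyz, f xyz p = c₀ := fun xyz => by
    simp [hf, Function.update_of_ne h3, Function.update_of_ne h2, Function.update_of_ne h1]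
  have hfq : ∀ xyz, f xyz q = c₀ := fun xyz => by
    simp [hf, Function.update_of_ne h6, Function.update_of_ne h5, Function.update_of_ne h4]
  have hinj : Set.InjOn f (univ : Finset (Fin 5 × Fin 5 × Fin 5)) := by
    intro a _ a' _ h
    have e1' := congrFun h e1; have e2' := congrFun h e2; have e3' := congrFun h e3
    rw [hf1, hf1] at e1'; rw [hf2, hf2] at e2'; rw [hf3, hf3] at e3'
    exact Prod.ext e1' (Prod.ext e2' e3')
  have hzero : ∀ v ∈ (univ : Finset (Fin 5 → Fin 5)), v ∉ univ.image f →
      (∏ j, if j ∈ ({p, q} : Finset (Fin 5)) then (if v j = c₀ then 1 else 0) else φ j (v j)) * w v = 0 := by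
    intro v _ hv
    by_contra hne
    apply hv
    have hP := prod_ne_zero_iff.mp (left_ne_zero_of_mul hne)
    have hvp : v p = c₀ := by
      have := hP p (mem_univ p); simp only [mem_insert, true_or, if_true] at this
      by_contra h; exact this (by simp [h])
    have hvq : v q = c₀ := by
      have := hP q (mem_univ q); simp only [mem_insert, mem_singleton, or_true, if_true] at this
      by_contra h; exact this (by simp [h])
    refine mem_image.mpr ⟨(v e1, v e2, v e3), mem_univ _, ?_⟩
    funext j
    rcases mem_of_five_distinct p q e1 e2 e3 j hpq h1 h2 h3 h4 h5 h6 h7 h8 h9 with rfl | rfl | rfl | rfl | rfl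
    · rw [hfp, hvp]
    · rw [hfq, hvq]
    · exact hf1 _
    · exact hf2 _
    · exact hf3 _
  rw [← sum_subset (subset_univ (univ.image f)) hzero, sum_image hinj]
  refine sum_congr rfl fun xyz _ => ?_
  have hprod : (∏ j, if j ∈ ({p, q} : Finset (Fin 5)) then (if f xyz j = c₀ then 1 else 0) else φ j (f xyz j)) =
      φ e1 xyz.1 * φ e2 xyz.2.1 * φ e3 xyz.2.2 := by
    have hsub : ({e1, e2, e3} : Finset (Fin 5)) ⊆ univ := subset_univ _
    rw [← Finset.prod_subset hsub]
    · rw [prod_insert (by simp [h7, h8]), prod_insert (by simp [h9]), prod_singleton]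
      simp [h1.symm, h4.symm, h2.symm, h5.symm, h3.symm, h6.symm, hf1, hf2, hf3, mul_assoc]
    · intro j _ hj
      simp only [mem_insert, mem_singleton, not_or] at hj
      rcases mem_of_five_distinct p q e1 e2 e3 j hpq h1 h2 h3 h4 h5 h6 h7 h8 h9 with rfl | rfl | h | h | h
      · simp [hfp]
      · simp [hfq]
      · exact absurd h hj.1
      · exact absurd h hj.2.1
      · exact absurd h hj.2.2
  rw [hprod]

/-! ### §2 The certified refutation -/

/-- **No decomposition of `P₅` admits a hybrid dual certificate.**  Slices `α_k(v_{i k}) · W_k(v)` (`k < Ns`), pair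
terms `u_t(v_{p t}, v_{q t}) · w_t(v)` (`t < Np`); certificate: order `ord`, `b` basis positions with columns `cb`,
kill side `side t` (`false`: the 2-slot side, charged at `lp t ∈ {p t, q t}` with the other endpoint `op t` earlier;
`true`: the 3-slot side `{e1 t, e2 t, lp t} = {p t, q t}ᶜ`, charged at `lp t` with `e1 t, e2 t` earlier), no term
charged to a basis slot, and the count condition.  Then the decomposition identity is impossible. -/
theorem certified_no_decomposition {Ns Np : ℕ}
    (i : Fin Ns → Fin 5) (α : Fin Ns → Fin 5 → ℂ) (W : Fin Ns → (Fin 5 → Fin 5) → ℂ)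
    (hW : ∀ k, ∀ v v' : Fin 5 → Fin 5, (∀ j, j ≠ i k → v j = v' j) → W k v = W k v')
    (p q : Fin Np → Fin 5) (hpq : ∀ t, p t ≠ q t) (u w : Fin Np → (Fin 5 → Fin 5) → ℂ)
    (hu : ∀ t, ∀ v v' : Fin 5 → Fin 5, v (p t) = v' (p t) → v (q t) = v' (q t) → u t v = u t v')
    (hw : ∀ t, ∀ v v' : Fin 5 → Fin 5, (∀ j, j ≠ p t → j ≠ q t → v j = v' j) → w t v = w t v')
    -- the certificate
    (ord : Equiv.Perm (Fin 5)) (b : ℕ) (hb : b ≤ 5) (cb : Fin 5 → Fin 5)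
    (hcb : ∀ j j' : Fin 5, (j : ℕ) < b → (j' : ℕ) < b → cb j = cb j' → j = j')
    (side : Fin Np → Bool) (lp op e1 e2 : Fin Np → Fin 5)
    (hsideU : ∀ t, side t = false → (lp t = p t ∧ op t = q t ∨ lp t = q t ∧ op t = p t) ∧
      ord.symm (op t) < ord.symm (lp t))
    (hsideW : ∀ t, side t = true → lp t ≠ p t ∧ lp t ≠ q t ∧ e1 t ≠ p t ∧ e1 t ≠ q t ∧ e2 t ≠ p t ∧ e2 t ≠ q t ∧
      e1 t ≠ e2 t ∧ e1 t ≠ lp t ∧ e2 t ≠ lp t ∧ ord.symm (e1 t) < ord.symm (lp t) ∧ ord.symm (e2 t) < ord.symm (lp t))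
    (hbasisS : ∀ k, b ≤ (ord.symm (i k) : ℕ)) (hbasisP : ∀ t, b ≤ (ord.symm (lp t) : ℕ))
    (hcount : ∀ j : Fin 5, b ≤ (j : ℕ) →
      (univ.filter (fun k => i k = ord j)).card + (univ.filter (fun t => lp t = ord j)).card + (j : ℕ) + 1 ≤ 5 ∨
      ((univ.filter (fun k => i k = ord j)).card + (univ.filter (fun t => lp t = ord j)).card + (j : ℕ) ≤ 5 ∧
        ∃ k, i k = ord j ∧ ∃ r : Fin 5, (r : ℕ) < b ∧ α k (cb r) ≠ 0)) :
    ¬ ∀ v : Fin 5 → Fin 5,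
      (if Function.Injective v then (1 : ℂ) else 0) = (∑ k, α k (v (i k)) * W k v) + ∑ t, u t v * w t v := by
  classical
  intro H
  -- the charged constraints, indexed by `Fin (Ns + Np)` (slices first)
  let c0 : Fin 5 := 0
  let nU : Fin Np → (Fin 5 → Fin 5 → ℂ) → (Fin 5 → ℂ) := fun t φ y =>
    ∑ a, φ (op t) a * u t (Function.update (Function.update (fun _ => c0) (op t) a) (lp t) y)
  let nW : Fin Np → (Fin 5 → Fin 5 → ℂ) → (Fin 5 → ℂ) := fun t φ z =>
    ∑ xy : Fin 5 × Fin 5, φ (e1 t) xy.1 * φ (e2 t) xy.2 *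
      w t (Function.update (Function.update (Function.update (fun _ => c0) (e1 t) xy.1) (e2 t) xy.2) (lp t) z)
  let l : Fin (Ns + Np) → Fin 5 := Fin.addCases (fun k => i k) (fun t => lp t)
  let Nv : Fin (Ns + Np) → (Fin 5 → Fin 5 → ℂ) → (Fin 5 → ℂ) :=
    Fin.addCases (fun k _ => α k) (fun t φ => if side t then nW t φ else nU t φ)
  have hl1 : ∀ k, l (Fin.castAdd Np k) = i k := fun k => by simp [l]
  have hl2 : ∀ t, l (Fin.natAdd Ns t) = lp t := fun t => by simp [l]
  have hN1 : ∀ k φ, Nv (Fin.castAdd Np k) φ = α k := fun k φ => by simp [Nv]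
  have hN2 : ∀ t φ, Nv (Fin.natAdd Ns t) φ = if side t then nW t φ else nU t φ := fun t φ => by simp [Nv]
  -- locality
  have hloc : ∀ s, ∀ φ φ' : Fin 5 → Fin 5 → ℂ, (∀ x, ord.symm x < ord.symm (l s) → φ x = φ' x) →
      Nv s φ = Nv s φ' := by
    intro s φ φ' hφ
    induction s using Fin.addCases with
    | left k => rw [hN1, hN1]
    | right t =>
      rw [hN2, hN2]
      rw [hl2] at hφ
      cases hst : side t
      · simp only [Bool.false_eq_true, if_false, nU]
        rw [hφ (op t) (hsideU t hst).2]
      · simp only [if_true, nW]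
        obtain ⟨-, -, -, -, -, -, -, -, -, he1, he2⟩ := hsideW t hst
        rw [hφ (e1 t) he1, hφ (e2 t) he2]
  have hbasis : ∀ s, b ≤ (ord.symm (l s) : ℕ) := by
    intro s
    induction s using Fin.addCases with
    | left k => rw [hl1]; exact hbasisS k
    | right t => rw [hl2]; exact hbasisP t
  -- the count in terms of `l`
  have hcard : ∀ s0 : Fin 5, (univ.filter (fun s => l s = s0)).card =
      (univ.filter (fun k => i k = s0)).card + (univ.filter (fun t => lp t = s0)).card := by
    intro s0
    rw [← Finset.card_map (finSumFinEquiv.symm.toEmbedding) ]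
    have : (univ.filter (fun s => l s = s0)).map finSumFinEquiv.symm.toEmbedding =
        (univ.filter (fun k : Fin Ns => i k = s0)).map Function.Embedding.inl ∪
          (univ.filter (fun t : Fin Np => lp t = s0)).map Function.Embedding.inr := by
      ext x
      simp only [mem_map, mem_filter, mem_univ, true_and, mem_union, Equiv.toEmbedding_apply,
        Function.Embedding.inl_apply, Function.Embedding.inr_apply]
      constructor
      · rintro ⟨s, hs, rfl⟩
        induction s using Fin.addCases with
        | left k => left; exact ⟨k, by rw [hl1] at hs; exact hs, by simp⟩
        | right t => right; exact ⟨t, by rw [hl2] at hs; exact hs, by simp⟩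
      · rintro (⟨k, hk, rfl⟩ | ⟨t, ht, rfl⟩)
        · exact ⟨Fin.castAdd Np k, by rw [hl1]; exact hk, by simp⟩
        · exact ⟨Fin.natAdd Ns t, by rw [hl2]; exact ht, by simp⟩
    rw [this, card_union_of_disjoint, card_map, card_map]
    rw [disjoint_left]
    rintro x hx hx'
    simp only [mem_map, Function.Embedding.inl_apply, Function.Embedding.inr_apply] at hx hx'
    obtain ⟨k, -, rfl⟩ := hx
    obtain ⟨t, -, h⟩ := hx'
    exact Sum.inr_ne_inl h
  have hcount' : ∀ j : Fin 5, b ≤ (j : ℕ) →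
      (univ.filter (fun s => l s = ord j)).card + (j : ℕ) + 1 ≤ 5 ∨
      ((univ.filter (fun s => l s = ord j)).card + (j : ℕ) ≤ 5 ∧
        ∃ s, l s = ord j ∧ ∃ r : Fin 5, (r : ℕ) < b ∧ ∀ φ, Nv s φ (cb r) ≠ 0) := by
    intro j hj
    rw [hcard]
    rcases hcount j hj with h | ⟨h, k, hk, r, hr, hα⟩
    · left; exact h
    · right; exact ⟨h, Fin.castAdd Np k, by rw [hl1]; exact hk, r, hr, fun φ => by rw [hN1]; exact hα⟩
  obtain ⟨φ, -, hkill, hper⟩ :=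
    LaplaceTriangular.hybrid_witness (n := 5) ord b hb cb hcb l Nv hloc hbasis hcount'
  -- the decomposition in the data format of `LaplaceOptimal 5`
  let S : Fin (Ns + Np) → Finset (Fin 5) := Fin.addCases (fun k => ({i k} : Finset (Fin 5))) (fun t => {p t, q t})
  let U : Fin (Ns + Np) → (Fin 5 → Fin 5) → ℂ := Fin.addCases (fun k v => α k (v (i k))) (fun t => u t)
  let V : Fin (Ns + Np) → (Fin 5 → Fin 5) → ℂ := Fin.addCases W (fun t => w t)
  have hS1 : ∀ k, S (Fin.castAdd Np k) = {i k} := fun k => by simp [S]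
  have hS2 : ∀ t, S (Fin.natAdd Ns t) = {p t, q t} := fun t => by simp [S]
  have hU1 : ∀ k, U (Fin.castAdd Np k) = fun v => α k (v (i k)) := fun k => by simp [U]
  have hU2 : ∀ t, U (Fin.natAdd Ns t) = u t := fun t => by simp [U]
  have hV1 : ∀ k, V (Fin.castAdd Np k) = W k := fun k => by simp [V]
  have hV2 : ∀ t, V (Fin.natAdd Ns t) = w t := fun t => by simp [V]
  refine LaplaceDual.no_decomposition_of_witness (d := 5) (univ : Finset (Fin (Ns + Np))) S U V ?_ ?_ c0 φ hper
    ?_ ?_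
  · intro s v v' hvv'
    induction s using Fin.addCases with
    | left k =>
      rw [hU1]
      have := hvv' (i k) (by rw [hS1]; simp)
      simp [this]
    | right t =>
      rw [hU2]
      exact hu t v v' (hvv' (p t) (by rw [hS2]; simp)) (hvv' (q t) (by rw [hS2]; simp))
  · intro s v v' hvv'
    induction s using Fin.addCases with
    | left k =>
      rw [hV1]
      exact hW k v v' (fun j hj => hvv' j (by rw [hS1]; simpa using hj))
    | right t =>
      rw [hV2]
      exact hw t v v' (fun j hjp hjq => hvv' j (by rw [hS2]; simp [hjp, hjq]))
  · -- every term is killed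
    intro s _
    induction s using Fin.addCases with
    | left k =>
      left
      rw [hS1, hU1]
      refine LaplaceDual.kill_slice (d := 5) c0 (i k) φ (fun v => α k (v (i k))) ?_
      have := hkill (Fin.castAdd Np k)
      rw [hl1, hN1] at this
      simpa [Function.update_self] using this
    | right t =>
      have hk := hkill (Fin.natAdd Ns t)
      rw [hl2, hN2] at hk
      cases hst : side t
      · -- u-side kill
        left
        rw [hS2, hU2]
        refine LaplaceDual.kill_pair (d := 5) c0 (p t) (q t) (hpq t) φ (u t) ?_
        simp only [hst, Bool.false_eq_true, if_false, nU] at hk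
        rcases (hsideU t hst).1 with ⟨hl, ho⟩ | ⟨hl, ho⟩
        · -- charged at `p t`, other endpoint `q t`
          rw [hl, ho] at hk
          rw [Fintype.sum_prod_type]
          rw [← hk]
          refine sum_congr rfl fun y _ => ?_
          rw [mul_sum]
          refine sum_congr rfl fun a _ => ?_
          rw [Function.update_comm (hpq t).symm]
          ring
        · -- charged at `q t`, other endpoint `p t`
          rw [hl, ho] at hk
          rw [Fintype.sum_prod_type, Finset.sum_comm, ← hk]
          refine sum_congr rfl fun y _ => ?_
          rw [mul_sum]
          exact sum_congr rfl fun a _ => by ring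
      · -- w-side kill
        right
        rw [hS2, hV2]
        obtain ⟨g1, g2, g3, g4, g5, g6, g7, g8, g9, -, -⟩ := hsideW t hst
        rw [pairing_compl_three c0 (p t) (q t) (e1 t) (e2 t) (lp t) (hpq t) g3.symm g5.symm g1.symm g4.symm
          g6.symm g2.symm g7 g8 g9 φ (w t)]
        simp only [hst, if_true, nW] at hk
        -- Σ_{x,y,z} … = Σ_z φ lp z · nW z
        rw [← hk]
        symm
        calc (∑ z, φ (lp t) z * ∑ xy : Fin 5 × Fin 5, φ (e1 t) xy.1 * φ (e2 t) xy.2 *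
                w t (Function.update (Function.update (Function.update (fun _ => c0) (e1 t) xy.1) (e2 t) xy.2)
                  (lp t) z))
            = ∑ z, ∑ xy : Fin 5 × Fin 5, φ (lp t) z * (φ (e1 t) xy.1 * φ (e2 t) xy.2 *
                w t (Function.update (Function.update (Function.update (fun _ => c0) (e1 t) xy.1) (e2 t) xy.2)
                  (lp t) z)) := by simp_rw [Finset.mul_sum]
          _ = ∑ zxy : Fin 5 × (Fin 5 × Fin 5), φ (lp t) zxy.1 * (φ (e1 t) zxy.2.1 * φ (e2 t) zxy.2.2 *
                w t (Function.update (Function.update (Function.update (fun _ => c0) (e1 t) zxy.2.1) (e2 t) zxy.2.2)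
                  (lp t) zxy.1)) := by rw [Fintype.sum_prod_type]
          _ = _ := by
            refine Fintype.sum_equiv ((Equiv.prodComm _ _).trans (Equiv.prodAssoc _ _ _)) _ _ (fun zxy => ?_)
            obtain ⟨z, x, y⟩ := zxy
            simp only [Equiv.trans_apply, Equiv.prodComm_apply, Prod.swap_prod_mk, Equiv.prodAssoc_apply]
            ring
  · -- the purported identity
    intro v
    rw [Fin.sum_univ_add]
    simp only [hU1, hU2, hV1, hV2]
    exact (H v).symm

end LaplaceFiveSlices

end Summit.ValiantsHypothesis.ValiantsHypothesis.Theorems.RigidityForcesSymmetryRankRigidMinimalRepr
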